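import Summits.Parity.GeneralizedHardyLittlewood.Theorems.LiouvilleMADEngineToGHL
import Summits.Parity.GeneralizedHardyLittlewood.Theorems.PairsToGHL.Negative.UnboundedSiegelZeros

/-!
# Route LiouvilleMAD — the crux `EngineToGHL` (stmt-Parity-14995) in the illusory world

Negative lane of the crux, transported from the shared residual through the unconditional
equivalence `EngineToGHL ↔ PairsToGHL` (`Theorems.EngineToGHL.engineToGHL_iff_pairsToGHL`,
p95950).  Everything is modulo the vendored theorem of Matomäki–Merikoski
(`Literature.Barriers.Parity.MatomakiMerikoski2023_pairCorrelation`, Theorem 1.3), exactly as in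
`Theorems/PairsToGHL/Negative/UnboundedSiegelZeros.lean`, whose
`not_generalizedHardyLittlewood_of_unboundedSiegelZeros` (Siegel zeros of unbounded quality refute
the SHIFT-UNIFORM Green–Tao conjecture, system `(n, n + 2q)` at `N = q¹⁰`) is the engine.

* `engineToGHL_false_of_unboundedSiegelZeros` — `UnboundedSiegelZeros → PairsHL → ¬EngineToGHL`;
* `engineToGHL_false_of_unboundedSiegelZeros_of_hyps` — in the illusory world the OTHER three
  hypotheses of the deciding theorem `closes` (the two MAD cruxes and Elliott–Halberstam, which give
  `PairsHL` by the proved glue) refute the fourth;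
* `not_unboundedSiegelZeros_of_hyps` / `siegelZeros_bounded_of_engineToGHL` — contrapositively, the
  four hypotheses of `closes` (indeed `EngineToGHL ∧ PairsHL` alone) bound the quality of Siegel
  zeros at large conductors: any proof of this crux usable by the route is a Landau–Siegel-type
  theorem;
* `engineToGHL_iff_generalizedHardyLittlewood_or_not_pairsHL` — the crux is `GHL ∨ ¬PairsHL`, so its
  only cheap proof would be a DISPROOF of binary Hardy–Littlewood (`engineToGHL_of_not_pairsHL`).
-/

namespace Summit.Parity.GeneralizedHardyLittlewood.Theorems.EngineToGHL

open Literature.Barriers.Parity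
open Summit.Parity.GeneralizedHardyLittlewood.Theses
open Summit.Parity.GeneralizedHardyLittlewood.Theses.LiouvilleMAD

/-- **The crux as a disjunction.** `EngineToGHL ↔ GeneralizedHardyLittlewood ∨ ¬PairsHL`: either
the full Green–Tao conjecture holds, or binary Hardy–Littlewood fails at some fixed shift.
[folklore] -/
theorem engineToGHL_iff_generalizedHardyLittlewood_or_not_pairsHL :
    EngineToGHL ↔ (_root_.GeneralizedHardyLittlewood ∨ ¬ LiouvilleShiftedTables.PairsHL) := by
  rw [engineToGHL_iff_pairsHL_imp_generalizedHardyLittlewood]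
  exact ⟨fun h => (Classical.em LiouvilleShiftedTables.PairsHL).imp h id,
    fun h hP => h.elim id fun hn => (hn hP).elim⟩

/-- The vacuous proof: a refutation of binary Hardy–Littlewood at one fixed shift would prove the
crux (and kill the route's purpose). [folklore] -/
theorem engineToGHL_of_not_pairsHL (hn : ¬ LiouvilleShiftedTables.PairsHL) : EngineToGHL :=
  engineToGHL_iff_generalizedHardyLittlewood_or_not_pairsHL.mpr (Or.inr hn)

/-- **The crux fails in the illusory world as soon as the routes deliver pairs.** Modulo
Matomäki–Merikoski: Siegel zeros of unbounded quality and `PairsHL` together refute `EngineToGHL`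
(transport of `PairsToGHL.Negative.pairsToGHL_false_of_unboundedSiegelZeros` along
`engineToGHL_iff_pairsToGHL`). [cite: MatomakiMerikoski2023, Theorem 1.3] -/
theorem engineToGHL_false_of_unboundedSiegelZeros : Literature.Barriers.Parity.MatomakiMerikoski2023_pairCorrelation → Literature.Barriers.Parity.UnboundedSiegelZeros → LiouvilleShiftedTables.PairsHL → ¬ EngineToGHL :=
  fun hMM hU hP h =>
    PairsToGHL.Negative.pairsToGHL_false_of_unboundedSiegelZeros hMM hU hP (pairsToGHL_of_engineToGHL h)

/-- **In the illusory world the other three hypotheses of `closes` refute the fourth.** Modulo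
Matomäki–Merikoski: under `UnboundedSiegelZeros`, the MAD cruxes `CosetDecorrelation`,
`FanDecorrelation` and `ElliottHalberstam` (which give `PairsHL` by the proved glue
`pairsHL_of_cosetDecorrelation_of_fanDecorrelation_of_elliottHalberstam`) make `EngineToGHL` FALSE.
[cite: MatomakiMerikoski2023, Theorem 1.3] -/
theorem engineToGHL_false_of_unboundedSiegelZeros_of_hyps
    (hMM : MatomakiMerikoski2023_pairCorrelation) (hU : UnboundedSiegelZeros)
    (h₁ : CosetDecorrelation) (h₂ : FanDecorrelation) (hEH : ElliottHalberstam) : ¬ EngineToGHL :=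
  engineToGHL_false_of_unboundedSiegelZeros hMM hU
    (pairsHL_of_cosetDecorrelation_of_fanDecorrelation_of_elliottHalberstam h₁ h₂ hEH)

/-- **The four hypotheses of `closes` exclude Siegel zeros of unbounded quality** (modulo
Matomäki–Merikoski): route LiouvilleMAD, if it closes, proves a Landau–Siegel-type theorem on the
way. [cite: MatomakiMerikoski2023, Theorem 1.3] -/
theorem not_unboundedSiegelZeros_of_hyps (hMM : MatomakiMerikoski2023_pairCorrelation)
    (h₁ : CosetDecorrelation) (h₂ : FanDecorrelation) (hEH : ElliottHalberstam) (hX : EngineToGHL) :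
    ¬ UnboundedSiegelZeros := fun hU =>
  engineToGHL_false_of_unboundedSiegelZeros_of_hyps hMM hU h₁ h₂ hEH hX

/-- **Landau–Siegel certificate of the crux.** From `EngineToGHL` and `PairsHL` (modulo
Matomäki–Merikoski) there are `η₀`, `q₀` such that no primitive quadratic character of conductor
`q ≥ q₀` has a Siegel zero of quality `η ≥ η₀`. [cite: MatomakiMerikoski2023, Theorem 1.3] -/
theorem siegelZeros_bounded_of_engineToGHL (hMM : MatomakiMerikoski2023_pairCorrelation)
    (hX : EngineToGHL) (hP : LiouvilleShiftedTables.PairsHL) :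
    ∃ η₀ : ℝ, ∃ q₀ : ℕ, ∀ (q : ℕ) [NeZero q] (χ : DirichletCharacter ℂ q) (η : ℝ),
      q₀ ≤ q → IsSiegelZero χ η → η < η₀ :=
  PairsToGHL.Negative.siegelZeros_bounded_of_pairsToGHL hMM (pairsToGHL_of_engineToGHL hX) hP

end Summit.Parity.GeneralizedHardyLittlewood.Theorems.EngineToGHL
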